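import Literature.NumberTheory.Automorphic.UnitaryTwoRamifiedTreeAction   -- ★ B-p08 (g28) ∕ F0P3a-p04 (g13): `exists_mem_unitaryGroupOfForm_conj_eq_smul_map` (unitary lifts), `diagonal_inv_mul_diagonal`, `diagonal_mul_mul_diagonal_apply`, `mem_unitaryGroupOfForm_iff`
import HarnessLib

/-!
# Standard position of a regular elliptic torus of `U(1,1)`: the descent of a regular elliptic unitary element is `GL₂(F)`-conjugate, by a determinant-one conjugator
# that LIFTS to the unitary group, into Labesse–Langlands' torus `{(a, b v₀; b, a + b u₀)}` of a (rescaled) quadratic datum (Serre, *Trees* II.1.2–1.3; Labesse–Langlands 1979 §2 p. 7)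

Topic `NumberTheory/Automorphic`; namespace `Literature.NumberTheory.Automorphic.UnitaryGroup`.  THEOREMS ONLY (no definition, no instance, no notation, no named fact,
no `sorry`); kernel lane.  Cell `pub/hodgecm-mathlib` (D-0151), crux H413 = `stmt-HodgeConjecture-24833`, line «N6nsGerm», road «W′» = «R1LL-WILD» (LEAD F0P3a-plan (g10)
WORD T9-25; architect A-p16 (g28) RULING A-45 (ii) «(B6-P) WLOG STANDARD POSITION», SPLIT 12:13Z: (P1) EXISTENCE = this seat A-p12 (g20), (P2) TRANSPORT = B-p14 (g33)
`core_of_core_conj`); consumers: the END-WILD HEAD (F0P3a-p03 (g13)), (B6-H) A-p13 (g32) and (B6) F0P3-p01 (g14) through their shared binder `hpos`.  THIS FILE is the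
GENERIC half (fields `F ⊂ E` along `ι`, an involution-like `σ` fixing `ι(F)`, a skew `α`): the place-level dress with `E₂`, the eigenframe and the valuation twist is the sequel
`Rogawski1990/RankOneTorusStandardPosition.lean`.
HONEST LABEL: HC_CM is proved only modulo the cell's 2 remaining named inputs (hLiu418, h413) until rung 0 closes; nothing printed is asserted here — elementary `2 × 2`
algebra over fields.

THE MATHEMATICS (2 × 2 Cayley–Hamilton is ★ `DeuringLadic.Matrix.sq_eq_trace_smul_sub_det_fin_two`; here only `simp; ring` on entries).  `u ∈ U(σ, Φ₂)`, `Φ₂ = (0 1; 1 0)`, descends as `diag(1,α) u diag(1,α)⁻¹ = s · ι(g)`, `g ∈ GL₂(F)` (★ `descent_of_mem_unitaryGroupOfForm_antidiag`).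
§1 CYCLIC VECTORS: a non-scalar `2 × 2` matrix is conjugate to the companion matrix `(0, −det; 1, tr)` (`exists_gl_conj_eq_companion`), so two non-scalar matrices with the
same trace and determinant are `GL₂(F)`-conjugate (`exists_gl_conj_eq_of_trace_eq_of_det_eq`).  §2 UNITARITY IN THE CONJUGATED FRAME: `σ(s)·s·ι(det g) = 1`
(`map_mul_mul_map_det_eq_one_of_conj_diagonal_eq`; in the frame `diag(1,α)` the form is `α⁻¹ J`, `J` alternating, `ᵗg J g = det g · J`).  §3 THE TORUS
(`exists_gl_conj_eq_torus`): if `u` is diagonalisable over `E` with DISTINCT eigenvalues `d₀ ≠ d₁` of `σ`-norm one, the eigenvalue `μ₀ = s⁻¹ d₀` of `ι(g)` is NOT in `ι(F)`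
(else `σ s·s·μ₀² = 1 = σ s·s·μ₀ μ₁`, forcing `d₀ = d₁`), hence `σ μ₀ = μ₁`; writing `μ₀ = ι a + ι b τ` (`b ≠ 0`) for a quadratic datum `(τ; u₀, v₀)` (`τ + στ = ι u₀`,
`τ στ = −ι v₀`, `E = ι F ⊕ ι F·τ`), `g` and `(a, b v₀; b, a + b u₀)` are non-scalar with the same trace `2a + b u₀` and determinant `a² + a b u₀ − b² v₀`, hence conjugate:
`h g h⁻¹ = (a, b v₀; b, a + b u₀) ∈ F[γ_τ]`, `γ_τ = (0, v₀; 1, u₀)`.  §4 The conjugator may be twisted by powers of `γ_τ` (`gl_mul_conj_eq_of_conj_eq`,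
`companion_zpow_mul_torus_comm`) and RESCALED to determinant one at the price of the datum `(τ; u₀, v₀) ↦ (c τ; c u₀, c² v₀)`, `c = det h`
(`exists_gl_det_one_conj_eq_torus_rescale`); a determinant-one conjugator LIFTS to `U(σ, Φ₂)` (★ `exists_mem_unitaryGroupOfForm_conj_eq_smul_map`, `s′ = 1`) and
`diag(1,α) (z u z⁻¹) diag(1,α)⁻¹ = s · ι(h′ g h′⁻¹)` (`exists_mem_unitaryGroupOfForm_conj_descent_eq`).

## References
* [Serre1980Trees] J.-P. Serre, *Trees* (1980), Ch. II §1.2–§1.3 (`GL₂`, `SL₂`, `PGL₂` over a local field; cyclic vectors).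
* [LabesseLanglands1979] J.-P. Labesse, R. P. Langlands, *L-indistinguishability for SL(2)*, Canad. J. Math. 31 (1979): §2 p. 7 (the torus `a + bτ`).
* [Rogawski1990] J. D. Rogawski, *Automorphic Representations of Unitary Groups in Three Variables* (1990): §3.6 p. 31 (`U(1,1)`, `SU(1,1) ≅ SL₂`).
* [Tits1979] J. Tits, *Reductive groups over local fields*, PSPM 33.1 (1979), §2.7, §3.9.
-/

set_option autoImplicit false

noncomputable section

open Matrix
open scoped Matrix MatrixGroups

namespace Literature.NumberTheory.Automorphic.UnitaryGroup

section Generic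

variable {F : Type*} [Field F] {E : Type*} [Field E] (ι : F →+* E) (σ : E →+* E)

/-- An intertwining `M · B = B · C` with `B` invertible is a conjugation `B⁻¹ M B = C`, packaged on `GL₂`. [cite: Serre1980Trees, Ch. II §1.2] -/
theorem exists_gl_conj_eq_of_mul_eq_mul {M C B : Matrix (Fin 2) (Fin 2) F} (hB : B.det ≠ 0) (h : M * B = B * C) :
    ∃ h : GL (Fin 2) F, (h : Matrix (Fin 2) (Fin 2) F) * M * ((h⁻¹ : GL (Fin 2) F) : Matrix (Fin 2) (Fin 2) F) = C := by
  refine ⟨(Matrix.GeneralLinearGroup.mkOfDetNeZero B hB)⁻¹, ?_⟩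
  rw [inv_inv, Matrix.GeneralLinearGroup.val_mkOfDetNeZero, Matrix.coe_units_inv, Matrix.GeneralLinearGroup.val_mkOfDetNeZero,
    Matrix.mul_assoc, h, ← Matrix.mul_assoc, Matrix.nonsing_inv_mul _ (isUnit_iff_ne_zero.2 hB), Matrix.one_mul]

/-- **CYCLIC VECTORS**: a non-scalar `2 × 2` matrix over a field is conjugate to the companion matrix `(0, −det; 1, tr)` of its characteristic polynomial.
[cite: Serre1980Trees, Ch. II §1.2] -/
theorem exists_gl_conj_eq_companion (M : Matrix (Fin 2) (Fin 2) F) (hM : ∀ c : F, M ≠ c • (1 : Matrix (Fin 2) (Fin 2) F)) :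
    ∃ h : GL (Fin 2) F, (h : Matrix (Fin 2) (Fin 2) F) * M * ((h⁻¹ : GL (Fin 2) F) : Matrix (Fin 2) (Fin 2) F) = !![0, -M.det; 1, M.trace] := by
  by_cases h10 : M 1 0 ≠ 0
  · -- cyclic vector `e₀`: `B = [e₀ | M e₀]`
    refine exists_gl_conj_eq_of_mul_eq_mul (B := !![1, M 0 0; 0, M 1 0]) (by rw [Matrix.det_fin_two_of]; simpa using h10) ?_
    ext i j
    fin_cases i <;> fin_cases j <;> simp [Matrix.mul_apply, Fin.sum_univ_two, Matrix.trace_fin_two, Matrix.det_fin_two] <;> ring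
  by_cases h01 : M 0 1 ≠ 0
  · -- cyclic vector `e₁`: `B = [e₁ | M e₁]`
    refine exists_gl_conj_eq_of_mul_eq_mul (B := !![0, M 0 1; 1, M 1 1]) (by rw [Matrix.det_fin_two_of]; simpa using h01) ?_
    ext i j
    fin_cases i <;> fin_cases j <;> simp [Matrix.mul_apply, Fin.sum_univ_two, Matrix.trace_fin_two, Matrix.det_fin_two] <;> ring
  push Not at h10 h01
  -- `M` is diagonal and non-scalar: cyclic vector `e₀ + e₁`
  have hne : M 0 0 ≠ M 1 1 := by
    intro heq
    refine hM (M 0 0) ?_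
    ext i j
    fin_cases i <;> fin_cases j <;> simp [h10, h01, heq]
  refine exists_gl_conj_eq_of_mul_eq_mul (B := !![1, M 0 0; 1, M 1 1]) (by rw [Matrix.det_fin_two_of]; simpa [sub_eq_zero] using hne.symm) ?_
  ext i j
  fin_cases i <;> fin_cases j <;> simp [Matrix.mul_apply, Fin.sum_univ_two, Matrix.trace_fin_two, Matrix.det_fin_two, h10, h01] <;> ring

/-- Two non-scalar `2 × 2` matrices with the same trace and determinant are conjugate under `GL₂(F)`. [cite: Serre1980Trees, Ch. II §1.2] -/
theorem exists_gl_conj_eq_of_trace_eq_of_det_eq (M M' : Matrix (Fin 2) (Fin 2) F) (hM : ∀ c : F, M ≠ c • (1 : Matrix (Fin 2) (Fin 2) F))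
    (hM' : ∀ c : F, M' ≠ c • (1 : Matrix (Fin 2) (Fin 2) F)) (htr : M.trace = M'.trace) (hdet : M.det = M'.det) :
    ∃ h : GL (Fin 2) F, (h : Matrix (Fin 2) (Fin 2) F) * M * ((h⁻¹ : GL (Fin 2) F) : Matrix (Fin 2) (Fin 2) F) = M' := by
  obtain ⟨h, hh⟩ := exists_gl_conj_eq_companion M hM
  obtain ⟨h', hh'⟩ := exists_gl_conj_eq_companion M' hM'
  refine ⟨h'⁻¹ * h, ?_⟩
  rw [← htr, ← hdet, ← hh] at hh'
  -- `h′ M′ h′⁻¹ = h M h⁻¹` ⇒ `(h′⁻¹ h) M (h′⁻¹ h)⁻¹ = M′`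
  have e : ((h'⁻¹ : GL (Fin 2) F) : Matrix (Fin 2) (Fin 2) F) * ((h : Matrix (Fin 2) (Fin 2) F) * M * ((h⁻¹ : GL (Fin 2) F) : Matrix (Fin 2) (Fin 2) F)) *
      ((h' : GL (Fin 2) F) : Matrix (Fin 2) (Fin 2) F) = M' := by
    rw [← hh', ← Matrix.mul_assoc, ← Matrix.mul_assoc, ← Units.val_mul, inv_mul_cancel, Units.val_one, Matrix.one_mul, Matrix.mul_assoc, ← Units.val_mul,
      inv_mul_cancel, Units.val_one, Matrix.mul_one]
  rw [_root_.mul_inv_rev, inv_inv, Units.val_mul, Units.val_mul, ← e]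
  simp only [Matrix.mul_assoc]

/-! ### The unitarity constraint in the descended frame, and the conjugation of the descent into the torus of a quadratic datum -/

/-- **UNITARITY IN THE CONJUGATED FRAME**: if `u ∈ U(σ, Φ₂)` descends as `diag(1,α) u diag(1,α)⁻¹ = s · ι(g)` (`σα = −α ≠ 0`, `σ ∘ ι = ι`), then `σ(s) · s · ι(det g) = 1`
(the `(0,1)` entry of `ᵗσ(u) Φ₂ u = Φ₂`; in the conjugated frame the form is `α⁻¹ J`, `J` alternating, and `ᵗg J g = det g · J`). Converse of ★
`exists_mem_unitaryGroupOfForm_conj_eq_smul_map`. [cite: Serre1980Trees, Ch. II §1.2–§1.3] [cite: Rogawski1990, §3.6 p. 31] -/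
theorem map_mul_mul_map_det_eq_one_of_conj_diagonal_eq (hσι : ∀ x : F, σ (ι x) = ι x) {α : E} (hα : σ α = -α) (hα0 : α ≠ 0)
    {y : GL (Fin 2) E} (hy : y ∈ unitaryGroupOfForm σ !![(0 : E), 1; 1, 0]) {s : E} {g : Matrix (Fin 2) (Fin 2) F}
    (hdesc : diagonal ![1, α] * (y : Matrix (Fin 2) (Fin 2) E) * diagonal ![1, α⁻¹] = s • g.map ι) :
    σ s * s * ι g.det = 1 := by
  -- the entries of `y` from the descent
  obtain ⟨e1, e2, e3, e4⟩ := diagonal_mul_mul_diagonal_apply (y : Matrix (Fin 2) (Fin 2) E) α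
  rw [hdesc] at e1 e2 e3 e4
  simp only [Matrix.smul_apply, Matrix.map_apply, smul_eq_mul] at e1 e2 e3 e4
  have y00 : (y : Matrix (Fin 2) (Fin 2) E) 0 0 = s * ι (g 0 0) := e1.symm
  have y01 : (y : Matrix (Fin 2) (Fin 2) E) 0 1 = s * ι (g 0 1) * α := by
    rw [e2, mul_assoc, inv_mul_cancel₀ hα0, mul_one]
  have y10 : (y : Matrix (Fin 2) (Fin 2) E) 1 0 = α⁻¹ * (s * ι (g 1 0)) := by
    rw [eq_inv_mul_iff_mul_eq₀ hα0, e3]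
  have y11 : (y : Matrix (Fin 2) (Fin 2) E) 1 1 = s * ι (g 1 1) := by
    rw [e4, mul_comm α, mul_assoc, mul_inv_cancel₀ hα0, mul_one]
  -- the `(0,1)` entry of the unitarity relation
  have hU : (((y : Matrix (Fin 2) (Fin 2) E).map σ)ᵀ * !![(0 : E), 1; 1, 0] * (y : Matrix (Fin 2) (Fin 2) E)) 0 1 = (!![(0 : E), 1; 1, 0]) 0 1 := by
    rw [mem_unitaryGroupOfForm_iff.1 hy]
  have hσα' : σ α⁻¹ = -α⁻¹ := by rw [map_inv₀, hα, inv_neg]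
  simp only [Matrix.mul_apply, Fin.sum_univ_two, Matrix.transpose_apply, Matrix.map_apply, y00, y01, y10, y11, map_mul, hσι, hσα',
    Matrix.of_apply, Matrix.cons_val', Matrix.cons_val_zero, Matrix.cons_val_one, Matrix.empty_val', Matrix.cons_val_fin_one,
    mul_zero, mul_one, zero_add, add_zero] at hU
  rw [Matrix.det_fin_two, map_sub, map_mul, map_mul]
  have hαα : α⁻¹ * α = 1 := inv_mul_cancel₀ hα0
  linear_combination hU + σ s * ι (g 1 0) * s * ι (g 0 1) * hαα


/-- **THE DESCENT OF A REGULAR ELLIPTIC UNITARY ELEMENT IS CONJUGATE INTO THE TORUS OF ANY QUADRATIC DATUM.**  Let `u ∈ U(σ, Φ₂)` descend as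
`diag(1,α) u diag(1,α)⁻¹ = s · ι(g)` and be diagonalisable over `E` with DISTINCT eigenvalues of `σ`-norm one (`u Q = Q diag(d)`, `det Q ≠ 0`, `d₀ ≠ d₁`, `σ(dᵢ) dᵢ = 1`),
and let `(τ; u₀, v₀)` be a quadratic datum of `E ∕ ι(F)` (`τ + στ = ι u₀`, `τ στ = −ι v₀`, `E = ι F ⊕ ι F·τ`).  Then `g` is `GL₂(F)`-conjugate to an element `(a, b v₀; b, a + b u₀)`,
`b ≠ 0`, of the torus `F[γ_τ]`, `γ_τ = (0, v₀; 1, u₀)` (Labesse–Langlands' torus).  Mechanism: the eigenvalue `μ₀ = s⁻¹ d₀` of `ι(g)` is NOT in `ι(F)` (else `σ s·s·μ₀² = 1 =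
σ s·s·μ₀μ₁` by the norm condition and the unitarity constraint, forcing `d₀ = d₁`), so `σ μ₀ = μ₁`, `μ₀ = ι a + ι b τ` with `b ≠ 0`, and `g`, `(a, b v₀; b, a + b u₀)` are two
non-scalar matrices with the same trace `2a + b u₀` and determinant `a² + a b u₀ − b² v₀` — conjugate by cyclic vectors.
[cite: LabesseLanglands1979, §2 p. 7] [cite: Serre1980Trees, Ch. II §1.2–§1.3] [cite: Rogawski1990, §3.6 p. 31] -/
theorem exists_gl_conj_eq_torus (hσι : ∀ x : F, σ (ι x) = ι x) (hfix : ∀ z : E, σ z = z → ∃ x : F, ι x = z)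
    {α : E} (hα : σ α = -α) (hα0 : α ≠ 0)
    {τ : E} {u₀ v₀ : F} (htr : τ + σ τ = ι u₀) (hnm : τ * σ τ = -ι v₀) (hbasis : ∀ z : E, ∃ p q : F, z = ι p + ι q * τ)
    {y : GL (Fin 2) E} (hy : y ∈ unitaryGroupOfForm σ !![(0 : E), 1; 1, 0]) {s : E} (hs0 : s ≠ 0) {g : GL (Fin 2) F}
    (hdesc : diagonal ![1, α] * (y : Matrix (Fin 2) (Fin 2) E) * diagonal ![1, α⁻¹] = s • (g : Matrix (Fin 2) (Fin 2) F).map ι)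
    {Q : Matrix (Fin 2) (Fin 2) E} (hQ : Q.det ≠ 0) {d : Fin 2 → E}
    (hyQ : (y : Matrix (Fin 2) (Fin 2) E) * Q = Q * diagonal d) (hd : d 0 ≠ d 1) (hd1 : ∀ i, σ (d i) * d i = 1) :
    ∃ (h : GL (Fin 2) F) (a b : F), b ≠ 0 ∧
      (h : Matrix (Fin 2) (Fin 2) F) * (g : Matrix (Fin 2) (Fin 2) F) * ((h⁻¹ : GL (Fin 2) F) : Matrix (Fin 2) (Fin 2) F) = !![a, b * v₀; b, a + b * u₀] := by
  set M : Matrix (Fin 2) (Fin 2) E := (g : Matrix (Fin 2) (Fin 2) F).map ι with hMdef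
  -- `M Q′ = Q′ diag(μ)` with `Q′ = diag(1,α) Q`, `μ = s⁻¹ d`
  have hQ' : (diagonal ![1, α] * Q).det ≠ 0 := by
    rw [Matrix.det_mul, Matrix.det_diagonal, Fin.prod_univ_two]
    simpa using mul_ne_zero hα0 hQ
  have hM : M = s⁻¹ • (diagonal ![1, α] * (y : Matrix (Fin 2) (Fin 2) E) * diagonal ![1, α⁻¹]) := by
    rw [hdesc, smul_smul, inv_mul_cancel₀ hs0, one_smul]
  have hMQ : M * (diagonal ![1, α] * Q) = (diagonal ![1, α] * Q) * diagonal (s⁻¹ • d) := by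
    rw [hM, Matrix.smul_mul, Matrix.mul_assoc, Matrix.mul_assoc, ← Matrix.mul_assoc (diagonal ![1, α⁻¹]), diagonal_inv_mul_diagonal hα0, Matrix.one_mul, hyQ,
      Matrix.diagonal_smul, Matrix.mul_smul, Matrix.mul_assoc]
  -- trace and determinant of `M`
  have hMeq : M = (diagonal ![1, α] * Q) * diagonal (s⁻¹ • d) * (diagonal ![1, α] * Q)⁻¹ := by
    rw [← hMQ, Matrix.mul_assoc, Matrix.mul_nonsing_inv _ (isUnit_iff_ne_zero.2 hQ'), Matrix.mul_one]
  have htrM : M.trace = s⁻¹ * d 0 + s⁻¹ * d 1 := by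
    rw [hMeq, Matrix.trace_mul_cycle, Matrix.nonsing_inv_mul _ (isUnit_iff_ne_zero.2 hQ'), Matrix.one_mul, Matrix.trace_diagonal, Fin.sum_univ_two]
    rfl
  have hdetM : M.det = (s⁻¹ * d 0) * (s⁻¹ * d 1) := by
    have h := congrArg Matrix.det hMQ
    rw [Matrix.det_mul M, Matrix.det_mul (diagonal ![1, α] * Q) (diagonal _), mul_comm M.det] at h
    have h' := mul_left_cancel₀ hQ' h
    rw [h', Matrix.det_diagonal, Fin.prod_univ_two]
    rfl
  have htrg : M.trace = ι (g : Matrix (Fin 2) (Fin 2) F).trace := by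
    rw [hMdef, Matrix.trace_fin_two, Matrix.trace_fin_two, map_add, Matrix.map_apply, Matrix.map_apply]
  have hdetg : M.det = ι (g : Matrix (Fin 2) (Fin 2) F).det := by
    rw [hMdef, ← RingHom.mapMatrix_apply, ← RingHom.map_det]
  -- the unitarity constraint and the norm condition
  have hA : σ s * s * ι (g : Matrix (Fin 2) (Fin 2) F).det = 1 := map_mul_mul_map_det_eq_one_of_conj_diagonal_eq ι σ hσι hα hα0 hy hdesc
  have hss : σ s * s ≠ 0 := by
    intro h0; rw [h0, zero_mul] at hA; exact zero_ne_one hA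
  have hμne : s⁻¹ * d 0 ≠ s⁻¹ * d 1 := fun h => hd (mul_left_cancel₀ (inv_ne_zero hs0) h)
  have hN0 : σ s * s * (σ (s⁻¹ * d 0) * (s⁻¹ * d 0)) = 1 := by
    rw [map_mul, map_inv₀]
    have hσs : σ s ≠ 0 := by rw [map_ne_zero]; exact hs0
    calc σ s * s * (((σ s)⁻¹ * σ (d 0)) * (s⁻¹ * d 0)) = (σ s * (σ s)⁻¹) * (s * s⁻¹) * (σ (d 0) * d 0) := by ring
      _ = 1 := by rw [mul_inv_cancel₀ hσs, mul_inv_cancel₀ hs0, hd1 0, one_mul, one_mul]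
  -- `μ₀ ∉ ι(F)`
  have hnotin : ∀ x : F, ι x ≠ s⁻¹ * d 0 := by
    intro x hx
    have hσμ : σ (s⁻¹ * d 0) = s⁻¹ * d 0 := by rw [← hx, hσι]
    have h1 : σ s * s * ((s⁻¹ * d 0) * (s⁻¹ * d 0)) = 1 := by rw [← hN0, hσμ]
    have h2 : σ s * s * ((s⁻¹ * d 0) * (s⁻¹ * d 1)) = 1 := by rw [← hdetM, hdetg, hA]
    have h3 : (s⁻¹ * d 0) * (s⁻¹ * d 0) = (s⁻¹ * d 0) * (s⁻¹ * d 1) := mul_left_cancel₀ hss (h1.trans h2.symm)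
    have hμ0 : s⁻¹ * d 0 ≠ 0 := by
      intro h0; rw [h0, mul_zero, mul_zero] at h1; exact zero_ne_one h1
    exact hμne (mul_left_cancel₀ hμ0 h3)
  have hσμne : σ (s⁻¹ * d 0) ≠ s⁻¹ * d 0 := by
    intro h
    obtain ⟨x, hx⟩ := hfix _ h
    exact hnotin x hx
  -- `σ μ₀ = μ₁`
  have hσtr : σ M.trace = M.trace := by rw [htrg, hσι]
  have hσdet : σ M.det = M.det := by rw [hdetg, hσι]
  have hroot : (s⁻¹ * d 0) * (s⁻¹ * d 0) - M.trace * (s⁻¹ * d 0) + M.det = 0 := by rw [htrM, hdetM]; ring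
  have hroot' : σ (s⁻¹ * d 0) * σ (s⁻¹ * d 0) - M.trace * σ (s⁻¹ * d 0) + M.det = 0 := by
    have h := congrArg σ hroot
    rw [map_add, map_sub, map_mul σ (s⁻¹ * d 0), map_mul σ M.trace, hσtr, hσdet, map_zero] at h
    exact h
  have hσμ : σ (s⁻¹ * d 0) = s⁻¹ * d 1 := by
    have hprod : (σ (s⁻¹ * d 0) - s⁻¹ * d 0) * (σ (s⁻¹ * d 0) - s⁻¹ * d 1) = 0 := by
      rw [htrM, hdetM] at hroot'
      linear_combination hroot'
    rcases mul_eq_zero.1 hprod with h0 | h0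
    · exact absurd (sub_eq_zero.1 h0) hσμne
    · exact sub_eq_zero.1 h0
  -- `μ₀ = ι a + ι b τ`, `b ≠ 0`
  obtain ⟨a, b, hab⟩ := hbasis (s⁻¹ * d 0)
  have hb : b ≠ 0 := by
    rintro rfl
    exact hnotin a (by rw [hab, map_zero, zero_mul, add_zero])
  -- the trace and determinant of `g`
  have htr' : (g : Matrix (Fin 2) (Fin 2) F).trace = 2 * a + b * u₀ := by
    apply ι.injective
    rw [← htrg, htrM, ← hσμ, hab]
    simp only [map_add, map_mul, map_ofNat, hσι]
    rw [← htr]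
    ring
  have hdet' : (g : Matrix (Fin 2) (Fin 2) F).det = a ^ 2 + a * b * u₀ - b ^ 2 * v₀ := by
    apply ι.injective
    have hv : ι v₀ = -(τ * σ τ) := by rw [hnm, neg_neg]
    rw [← hdetg, hdetM, ← hσμ, hab]
    simp only [map_add, map_mul, map_sub, map_pow, hσι]
    rw [← htr, hv]
    ring
  -- both sides are non-scalar with the same invariants
  have hgns : ∀ c : F, (g : Matrix (Fin 2) (Fin 2) F) ≠ c • (1 : Matrix (Fin 2) (Fin 2) F) := by
    intro c hc
    have htc : (g : Matrix (Fin 2) (Fin 2) F).trace = c + c := by rw [hc, Matrix.trace_smul, Matrix.trace_one, Fintype.card_fin]; simp; ring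
    have hdc : (g : Matrix (Fin 2) (Fin 2) F).det = c * c := by rw [hc, Matrix.det_smul, Matrix.det_one, Fintype.card_fin, mul_one, pow_two]
    have hsq : (s⁻¹ * d 0 - s⁻¹ * d 1) ^ 2 = M.trace ^ 2 - 4 * M.det := by rw [htrM, hdetM]; ring
    rw [htrg, hdetg, htc, hdc, map_add, map_mul] at hsq
    have h0 : (s⁻¹ * d 0 - s⁻¹ * d 1) ^ 2 = 0 := by rw [hsq]; ring
    exact hμne (sub_eq_zero.1 (pow_eq_zero_iff two_ne_zero |>.1 h0))
  have hTns : ∀ c : F, !![a, b * v₀; b, a + b * u₀] ≠ c • (1 : Matrix (Fin 2) (Fin 2) F) := by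
    intro c hc
    have h10 := congrFun (congrFun hc 1) 0
    simp at h10
    exact hb h10
  have hTtr : (g : Matrix (Fin 2) (Fin 2) F).trace = (!![a, b * v₀; b, a + b * u₀]).trace := by
    rw [htr', Matrix.trace_fin_two_of]; ring
  have hTdet : (g : Matrix (Fin 2) (Fin 2) F).det = (!![a, b * v₀; b, a + b * u₀]).det := by
    rw [hdet', Matrix.det_fin_two_of]; ring
  obtain ⟨h, hh⟩ := exists_gl_conj_eq_of_trace_eq_of_det_eq _ _ hgns hTns hTtr hTdet
  exact ⟨h, a, b, hb, hh⟩


/-! ### Twisting the conjugator inside the torus, rescaling the datum to determinant one, and the unitary lift -/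

/-- A conjugator into the torus may be multiplied on the left by anything commuting with the target (e.g. a power of `γ_τ`). [cite: Serre1980Trees, Ch. II §1.2] -/
theorem gl_mul_conj_eq_of_conj_eq {g h k : GL (Fin 2) F} {T : Matrix (Fin 2) (Fin 2) F}
    (hh : (h : Matrix (Fin 2) (Fin 2) F) * (g : Matrix (Fin 2) (Fin 2) F) * ((h⁻¹ : GL (Fin 2) F) : Matrix (Fin 2) (Fin 2) F) = T)
    (hk : (k : Matrix (Fin 2) (Fin 2) F) * T = T * (k : Matrix (Fin 2) (Fin 2) F)) :
    ((k * h : GL (Fin 2) F) : Matrix (Fin 2) (Fin 2) F) * (g : Matrix (Fin 2) (Fin 2) F) * (((k * h)⁻¹ : GL (Fin 2) F) : Matrix (Fin 2) (Fin 2) F) = T := by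
  rw [_root_.mul_inv_rev, Units.val_mul, Units.val_mul]
  calc (k : Matrix (Fin 2) (Fin 2) F) * (h : Matrix (Fin 2) (Fin 2) F) * (g : Matrix (Fin 2) (Fin 2) F) *
        (((h⁻¹ : GL (Fin 2) F) : Matrix (Fin 2) (Fin 2) F) * ((k⁻¹ : GL (Fin 2) F) : Matrix (Fin 2) (Fin 2) F))
        = (k : Matrix (Fin 2) (Fin 2) F) * ((h : Matrix (Fin 2) (Fin 2) F) * (g : Matrix (Fin 2) (Fin 2) F) * ((h⁻¹ : GL (Fin 2) F) : Matrix (Fin 2) (Fin 2) F)) *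
            ((k⁻¹ : GL (Fin 2) F) : Matrix (Fin 2) (Fin 2) F) := by simp only [Matrix.mul_assoc]
    _ = T * ((k : Matrix (Fin 2) (Fin 2) F) * ((k⁻¹ : GL (Fin 2) F) : Matrix (Fin 2) (Fin 2) F)) := by rw [hh, hk, Matrix.mul_assoc]
    _ = T := by rw [← Units.val_mul, mul_inv_cancel, Units.val_one, Matrix.mul_one]

/-- `γ_τ = (0, v₀; 1, u₀)` commutes with every `(a, b v₀; b, a + b u₀) = a·1 + b·γ_τ`. [cite: LabesseLanglands1979, §2 p. 7] -/
theorem companion_mul_torus_comm (a b u₀ v₀ : F) :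
    !![0, v₀; 1, u₀] * !![a, b * v₀; b, a + b * u₀] = !![a, b * v₀; b, a + b * u₀] * !![0, v₀; 1, u₀] := by
  ext i j
  fin_cases i <;> fin_cases j <;> simp [Matrix.mul_apply, Fin.sum_univ_two] <;> ring

/-- … hence so does every integer power of a unit `γ` with `↑γ = γ_τ`. [cite: LabesseLanglands1979, §2 p. 7] -/
theorem companion_zpow_mul_torus_comm {γ : GL (Fin 2) F} {u₀ v₀ : F} (hγ : (γ : Matrix (Fin 2) (Fin 2) F) = !![0, v₀; 1, u₀]) (a b : F) (k : ℤ) :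
    ((γ ^ k : GL (Fin 2) F) : Matrix (Fin 2) (Fin 2) F) * !![a, b * v₀; b, a + b * u₀] = !![a, b * v₀; b, a + b * u₀] * ((γ ^ k : GL (Fin 2) F) : Matrix (Fin 2) (Fin 2) F) := by
  -- `Commute ↑γ T` gives `Commute ↑(γ^k) T` through the units structure
  have hc : Commute (γ : Matrix (Fin 2) (Fin 2) F) !![a, b * v₀; b, a + b * u₀] := by
    rw [Commute, SemiconjBy, hγ]; exact companion_mul_torus_comm a b u₀ v₀
  exact (hc.symm.units_zpow_right k).symm

/-- **RESCALING TO DETERMINANT ONE**: if `h g h⁻¹ = (a, b v₀; b, a + b u₀)` and `c := det h`, then `h′ := diag(1,c)⁻¹ h` has `det h′ = 1` and conjugates `g` to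
`(a, b′·(c² v₀); b′, a + b′·(c u₀))`, `b′ = b ∕ c` — the torus of the RESCALED datum `(c τ; c u₀, c² v₀)`. [cite: LabesseLanglands1979, §2 p. 7] [cite: Serre1980Trees, Ch. II §1.2] -/
theorem exists_gl_det_one_conj_eq_torus_rescale {g h : GL (Fin 2) F} {a b u₀ v₀ : F}
    (hh : (h : Matrix (Fin 2) (Fin 2) F) * (g : Matrix (Fin 2) (Fin 2) F) * ((h⁻¹ : GL (Fin 2) F) : Matrix (Fin 2) (Fin 2) F) = !![a, b * v₀; b, a + b * u₀]) :
    ∃ h' : GL (Fin 2) F, (h' : Matrix (Fin 2) (Fin 2) F).det = 1 ∧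
      (h' : Matrix (Fin 2) (Fin 2) F) * (g : Matrix (Fin 2) (Fin 2) F) * ((h'⁻¹ : GL (Fin 2) F) : Matrix (Fin 2) (Fin 2) F) =
        !![a, (b / (h : Matrix (Fin 2) (Fin 2) F).det) * ((h : Matrix (Fin 2) (Fin 2) F).det ^ 2 * v₀); b / (h : Matrix (Fin 2) (Fin 2) F).det,
          a + (b / (h : Matrix (Fin 2) (Fin 2) F).det) * ((h : Matrix (Fin 2) (Fin 2) F).det * u₀)] := by
  set c : F := (h : Matrix (Fin 2) (Fin 2) F).det with hcdef
  have hc0 : c ≠ 0 := (h.isUnit.map Matrix.detMonoidHom).ne_zero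
  have hDdet : (diagonal ![(1 : F), c]).det ≠ 0 := by rw [Matrix.det_diagonal, Fin.prod_univ_two]; simpa using hc0
  set D : GL (Fin 2) F := Matrix.GeneralLinearGroup.mkOfDetNeZero _ hDdet with hDdef
  have hDval : (D : Matrix (Fin 2) (Fin 2) F) = diagonal ![1, c] := rfl
  have hDinv : ((D⁻¹ : GL (Fin 2) F) : Matrix (Fin 2) (Fin 2) F) = diagonal ![1, c⁻¹] := by
    rw [Matrix.coe_units_inv, hDval]
    exact Matrix.inv_eq_left_inv (diagonal_inv_mul_diagonal hc0)
  refine ⟨D⁻¹ * h, ?_, ?_⟩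
  · rw [Units.val_mul, Matrix.det_mul, hDinv, Matrix.det_diagonal, Fin.prod_univ_two]
    simp [hc0, ← hcdef]
  · rw [_root_.mul_inv_rev, inv_inv, Units.val_mul, Units.val_mul, hDinv, hDval]
    calc diagonal ![1, c⁻¹] * (h : Matrix (Fin 2) (Fin 2) F) * (g : Matrix (Fin 2) (Fin 2) F) * (((h⁻¹ : GL (Fin 2) F) : Matrix (Fin 2) (Fin 2) F) * diagonal ![1, c])
          = diagonal ![1, c⁻¹] * ((h : Matrix (Fin 2) (Fin 2) F) * (g : Matrix (Fin 2) (Fin 2) F) * ((h⁻¹ : GL (Fin 2) F) : Matrix (Fin 2) (Fin 2) F)) * diagonal ![1, c] := by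
            simp only [Matrix.mul_assoc]
      _ = _ := by
            rw [hh]
            ext i j
            fin_cases i <;> fin_cases j
            · simp [Matrix.mul_apply, Matrix.diagonal]
            · simp [Matrix.mul_apply, Matrix.diagonal]
              field_simp
            · simp [Matrix.mul_apply, Matrix.diagonal]
              rw [div_eq_inv_mul]
            · simp [Matrix.mul_apply, Matrix.diagonal]
              field_simp

/-- **THE UNITARY LIFT OF A DETERMINANT-ONE CONJUGATOR, AND ITS EFFECT ON THE DESCENT**: if `u ∈ U(σ, Φ₂)` descends as `diag(1,α) u diag(1,α)⁻¹ = s · ι(g)` and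
`h′ ∈ GL₂(F)` has `det h′ = 1`, there is `z ∈ U(σ, Φ₂)` (★ `exists_mem_unitaryGroupOfForm_conj_eq_smul_map`, `s′ = 1`) with
`diag(1,α) (z u z⁻¹) diag(1,α)⁻¹ = s · ι(h′ g h′⁻¹)`. [cite: Serre1980Trees, Ch. II §1.2–§1.3] [cite: Tits1979, §2.7 and §3.9] -/
theorem exists_mem_unitaryGroupOfForm_conj_descent_eq (hσι : ∀ x : F, σ (ι x) = ι x) {α : E} (hα : σ α = -α) (hα0 : α ≠ 0)
    {y : GL (Fin 2) E} {s : E} {g : GL (Fin 2) F}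
    (hdesc : diagonal ![1, α] * (y : Matrix (Fin 2) (Fin 2) E) * diagonal ![1, α⁻¹] = s • (g : Matrix (Fin 2) (Fin 2) F).map ι)
    {h' : GL (Fin 2) F} (hdet : (h' : Matrix (Fin 2) (Fin 2) F).det = 1) :
    ∃ z : ↥(unitaryGroupOfForm σ !![(0 : E), 1; 1, 0]),
      diagonal ![1, α] * (((z : GL (Fin 2) E) * y * (z : GL (Fin 2) E)⁻¹ : GL (Fin 2) E) : Matrix (Fin 2) (Fin 2) E) * diagonal ![1, α⁻¹] =
        s • ((h' : Matrix (Fin 2) (Fin 2) F) * (g : Matrix (Fin 2) (Fin 2) F) * ((h'⁻¹ : GL (Fin 2) F) : Matrix (Fin 2) (Fin 2) F)).map ι := by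
  obtain ⟨z, hz⟩ := exists_mem_unitaryGroupOfForm_conj_eq_smul_map ι σ hσι hα hα0 (s := 1) (g := h')
    (by rw [map_one, one_mul, one_mul, hdet, map_one])
  rw [one_smul] at hz
  refine ⟨z, ?_⟩
  -- `diag(1,α) z⁻¹ diag(1,α)⁻¹ = ι(h′⁻¹)`
  have hι1 : (h' : Matrix (Fin 2) (Fin 2) F).map ι * ((h'⁻¹ : GL (Fin 2) F) : Matrix (Fin 2) (Fin 2) F).map ι = 1 := by
    rw [← Matrix.map_mul, ← Units.val_mul, mul_inv_cancel, Units.val_one, Matrix.map_one ι (map_zero ι) (map_one ι)]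
  have hz1 : (diagonal ![1, α] * ((z : GL (Fin 2) E) : Matrix (Fin 2) (Fin 2) E) * diagonal ![1, α⁻¹]) *
      (diagonal ![1, α] * (((z : GL (Fin 2) E)⁻¹ : GL (Fin 2) E) : Matrix (Fin 2) (Fin 2) E) * diagonal ![1, α⁻¹]) = 1 := by
    calc (diagonal ![1, α] * ((z : GL (Fin 2) E) : Matrix (Fin 2) (Fin 2) E) * diagonal ![1, α⁻¹]) *
          (diagonal ![1, α] * (((z : GL (Fin 2) E)⁻¹ : GL (Fin 2) E) : Matrix (Fin 2) (Fin 2) E) * diagonal ![1, α⁻¹])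
          = diagonal ![1, α] * ((z : GL (Fin 2) E) : Matrix (Fin 2) (Fin 2) E) * (diagonal ![1, α⁻¹] * diagonal ![1, α]) *
              (((z : GL (Fin 2) E)⁻¹ : GL (Fin 2) E) : Matrix (Fin 2) (Fin 2) E) * diagonal ![1, α⁻¹] := by simp only [Matrix.mul_assoc]
      _ = 1 := by
            rw [diagonal_inv_mul_diagonal hα0, Matrix.mul_one, Matrix.mul_assoc (diagonal ![1, α]), ← Units.val_mul, mul_inv_cancel, Units.val_one, Matrix.mul_one,
              diagonal_mul_diagonal_inv hα0]
  have hzinv : diagonal ![1, α] * (((z : GL (Fin 2) E)⁻¹ : GL (Fin 2) E) : Matrix (Fin 2) (Fin 2) E) * diagonal ![1, α⁻¹] = ((h'⁻¹ : GL (Fin 2) F) : Matrix (Fin 2) (Fin 2) F).map ι := by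
    rw [hz] at hz1
    rw [← Matrix.inv_eq_right_inv hz1, Matrix.inv_eq_right_inv hι1]
  calc diagonal ![1, α] * (((z : GL (Fin 2) E) * y * (z : GL (Fin 2) E)⁻¹ : GL (Fin 2) E) : Matrix (Fin 2) (Fin 2) E) * diagonal ![1, α⁻¹]
        = (diagonal ![1, α] * ((z : GL (Fin 2) E) : Matrix (Fin 2) (Fin 2) E) * diagonal ![1, α⁻¹]) * (diagonal ![1, α] * (y : Matrix (Fin 2) (Fin 2) E) * diagonal ![1, α⁻¹]) *
            (diagonal ![1, α] * (((z : GL (Fin 2) E)⁻¹ : GL (Fin 2) E) : Matrix (Fin 2) (Fin 2) E) * diagonal ![1, α⁻¹]) := by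
          rw [Units.val_mul, Units.val_mul]
          simp only [Matrix.mul_assoc]
          rw [← Matrix.mul_assoc (diagonal ![1, α⁻¹]) (diagonal ![1, α]), diagonal_inv_mul_diagonal hα0, Matrix.one_mul,
            ← Matrix.mul_assoc (diagonal ![1, α⁻¹]) (diagonal ![1, α]), diagonal_inv_mul_diagonal hα0, Matrix.one_mul]
    _ = s • ((h' : Matrix (Fin 2) (Fin 2) F) * (g : Matrix (Fin 2) (Fin 2) F) * ((h'⁻¹ : GL (Fin 2) F) : Matrix (Fin 2) (Fin 2) F)).map ι := by
          rw [hz, hdesc, hzinv, Matrix.map_mul, Matrix.map_mul, Matrix.mul_smul, Matrix.smul_mul]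


end Generic

end Literature.NumberTheory.Automorphic.UnitaryGroup

end
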